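import Literature.AlgebraicGeometry.Resolution.HasSNCStrictNormalCrossings
import Literature.AlgebraicGeometry.Resolution.BlowupSNC
import Literature.AlgebraicGeometry.Resolution.RsopMonomialIdeals
import HarnessLib

/-!
# A configuration of regular, pairwise transversal curves with no triple point is a strict normal
# crossings divisor (The Stacks Project, Lemma 54.15.6 = Tag 0BIC, proof ¶2, last sentence; Étale
# Morphisms Lemma 41.21.2 = Tag 0BIA)

Topic: `Literature/AlgebraicGeometry/Resolution`. Theorem-only file (sorry-free, no definitions, no named
facts), brick (v) toward the discharge of the named fact F-75c
`Stacks0BIC_embeddedResolutionCurvesInSurfaces_locus` (`EmbeddedResolutionCurvesInSurfaces.lean`).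

Printed (Tag 0BIC, proof ¶2): «we reach the situation where for every closed point `p ∈ X` there is either
(a) no curves `Y_i` passing through `p`, (b) exactly one curve `Y_i` passing through `p` and `𝒪_{Y_i,p}` is
regular, or (c) exactly two curves `Y_i, Y_j` passing through `p`, the local rings `𝒪_{Y_i,p}, 𝒪_{Y_j,p}`
are regular and `m_p(Y_i ∩ Y_j) = 1`. This means that `Σ Y_i` is a strict normal crossings divisor on the
regular surface `X`, see Étale Morphisms, Lemma 41.21.2.»

Typed in LOCAL form, for a finite family `𝒞` of closed subsets of a scheme `X` with regular local rings
(no dimension or integrality hypothesis; the members may be curves, exceptional curves or isolated closed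
points of a one-dimensional component): (b) ↦ at a point `p` of a member `C` its reduced ideal has germ
`I(C)_p = (f)` with `f` PART OF A REGULAR SYSTEM OF PARAMETERS of `𝒪_{X,p}` (`IsRsopPart ![f]`, i.e.
`f ∈ 𝔪_p ∖ 𝔪_p²`: `𝒪_{C,p} = 𝒪_{X,p}/(f)` regular); (c) ↦ at a common point of two members their germs
are `(f)`, `(g)` with `(f, g)` part of a regular system of parameters (`m_p = ℓ(𝒪/(f)+(g)) = 1` on a
surface); «at most two» ↦ no point lies on three distinct members. Conclusion: `⋃ C` is a strict normal
crossings divisor (`IsStrictNormalCrossingsDivisor`, de Jong's closed-subset idiom), through the tree's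
list idiom `HasSNC` (`hasSNC_of_labels`, `BlowupSNC.lean`; `HasSNC.isStrictNormalCrossingsDivisor_biUnion_support`,
`HasSNCStrictNormalCrossings.lean` = Tag 0BIA (1) ⇒ (2)).

* `hasSNC_of_curveConfiguration` — the list of the reduced ideals of the members has simple normal crossings;
* `isStrictNormalCrossingsDivisor_biUnion_of_curveConfiguration` — **`⋃_{C ∈ 𝒞} C` is a strict normal
  crossings divisor.**

AI-written; weaker than expert review. Not a statement of [Hironaka2017].

## References
* The Stacks Project, Tag 0BIC (Lemma 54.15.6, proof ¶2), Tag 0BIA (Lemma 41.21.2). [StacksProject]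
* E. Bierstone, D. Grigoriev, P. Milman, J. Włodarczyk (2011), Def. 3.1.1. [BierstoneGrigorievMilmanWlodarczyk2011]
-/

noncomputable section

open CategoryTheory AlgebraicGeometry TopologicalSpace IsLocalRing

universe u

namespace Literature.AlgebraicGeometry.Resolution

open Scheme.IdealSheafData

variable {X : Scheme.{u}}

/-- The per-point clause of `hasSNC_of_labels` from a part of a regular system of parameters labelling the
members through the point. [cite: BierstoneGrigorievMilmanWlodarczyk2011, Def. 3.1.1] -/
private theorem labels_of_isRsopPart (E : List X.IdealSheafData) {x : X} {n : ℕ}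
    {z : Fin n → X.presheaf.stalk x} (hz : IsRsopPart z)
    (lab : {D : X.IdealSheafData // D ∈ E ∧ x ∈ D.support} → Fin n) (hlab : Function.Injective lab)
    (hD : ∀ D, stalkIdeal D.1 x = Ideal.span {z (lab D)}) :
    IsRegularLocalRing (X.presheaf.stalk x) ∧
      ∃ (d : ℕ) (v : Fin d → X.presheaf.stalk x), (maximalIdeal (X.presheaf.stalk x)).spanFinrank = d ∧
        Ideal.span (Set.range v) = maximalIdeal (X.presheaf.stalk x) ∧
        ∃ ι : {D : X.IdealSheafData // D ∈ E ∧ x ∈ D.support} → Fin d,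
          Function.Injective ι ∧ ∀ D, stalkIdeal D.1 x = Ideal.span {v (ι D)} := by
  obtain ⟨e, v, hd, hv, hvz⟩ := hz.exists_rsop
  refine ⟨hz.isRegularLocalRing, n + e, v, hd, hv, fun D => Fin.castAdd e (lab D),
    fun D₁ D₂ h => hlab (Fin.castAdd_injective _ _ h), fun D => ?_⟩
  rw [hD D, hvz]

/-- **A configuration of regular, pairwise transversal hypersurface germs with no triple point has simple
normal crossings** (list idiom): for a finite family `𝒞` of closed subsets of `X` such that (o) every local
ring of `X` is regular, (b) at each point `p` of a member `C`, `I(C)_p = (f)` with `f` part of a regular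
system of parameters, (c) at each common point of two distinct members `C, C'`, `I(C)_p = (f)`,
`I(C')_p = (g)` with `(f, g)` part of a regular system of parameters, and (n) no point lies on three distinct
members — the list of the ideals `I(C)`, `C ∈ 𝒞`, has simple normal crossings.
[cite: StacksProject, Tag 0BIC (Lemma 54.15.6, proof ¶2)] [cite: BierstoneGrigorievMilmanWlodarczyk2011, Def. 3.1.1] -/
theorem hasSNC_of_curveConfiguration (hreg : ∀ x : X, IsRegularLocalRing (X.presheaf.stalk x))
    {𝒞 : Set (Closeds X)} (hfin : 𝒞.Finite)
    (hb : ∀ C ∈ 𝒞, ∀ p ∈ (C : Set X), ∃ f : X.presheaf.stalk p,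
      IsRsopPart ![f] ∧ stalkIdeal (vanishingIdeal C) p = Ideal.span {f})
    (hc : ∀ C ∈ 𝒞, ∀ C' ∈ 𝒞, C ≠ C' → ∀ p ∈ (C : Set X) ∩ (C' : Set X),
      ∃ f g : X.presheaf.stalk p, IsRsopPart ![f, g] ∧
        stalkIdeal (vanishingIdeal C) p = Ideal.span {f} ∧ stalkIdeal (vanishingIdeal C') p = Ideal.span {g})
    (hn : ∀ p : X, ∀ C₁ ∈ 𝒞, ∀ C₂ ∈ 𝒞, ∀ C₃ ∈ 𝒞, p ∈ (C₁ : Set X) → p ∈ (C₂ : Set X) → p ∈ (C₃ : Set X) →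
      C₁ = C₂ ∨ C₁ = C₃ ∨ C₂ = C₃) :
    HasSNC ((hfin.toFinset.toList).map fun C => vanishingIdeal C) := by
  classical
  set E : List X.IdealSheafData := (hfin.toFinset.toList).map fun C => vanishingIdeal C with hE
  -- membership in `E` and in supports
  have hmemE : ∀ {D : X.IdealSheafData}, D ∈ E ↔ ∃ C ∈ 𝒞, vanishingIdeal C = D := by
    intro D
    simp only [hE, List.mem_map, Finset.mem_toList, Set.Finite.mem_toFinset]
  have hsupp : ∀ {C : Closeds X} {x : X}, x ∈ (vanishingIdeal C).support ↔ x ∈ (C : Set X) := by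
    intro C x
    rw [← SetLike.mem_coe, coe_support_vanishingIdeal]
  have hinjV : ∀ {C C' : Closeds X}, vanishingIdeal C = vanishingIdeal C' → C = C' := by
    intro C C' h
    have h1 := congrArg (fun I : X.IdealSheafData => ((I.support : Closeds X) : Set X)) h
    simp only [coe_support_vanishingIdeal] at h1
    exact Closeds.ext h1
  -- every member of `E` through `x` comes from a member of `𝒞` through `x`
  have hthrough : ∀ {x : X} (D : {D : X.IdealSheafData // D ∈ E ∧ x ∈ D.support}),
      ∃ C ∈ 𝒞, vanishingIdeal C = D.1 ∧ x ∈ (C : Set X) := by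
    rintro x ⟨D, hD, hxD⟩
    obtain ⟨C, hC, rfl⟩ := hmemE.mp hD
    exact ⟨C, hC, rfl, hsupp.mp hxD⟩
  refine hasSNC_of_labels E fun x => ?_
  by_cases h0 : ∃ C ∈ 𝒞, x ∈ (C : Set X)
  swap
  · -- (a) no member through `x`
    haveI := hreg x
    obtain ⟨u, hu⟩ := exists_regularSystemOfParameters (R := X.presheaf.stalk x)
    have hz : IsRsopPart (u ∘ (Fin.elim0 : Fin 0 → _)) :=
      isRsopPart_comp_of_rsop rfl u hu _ fun a => a.elim0
    refine labels_of_isRsopPart E hz (fun D => ?_) (fun D => ?_) (fun D => ?_) <;>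
    · exfalso
      obtain ⟨C, hC, -, hxC⟩ := hthrough D
      exact h0 ⟨C, hC, hxC⟩
  obtain ⟨C₀, hC₀, hxC₀⟩ := h0
  by_cases h1 : ∃ C' ∈ 𝒞, C' ≠ C₀ ∧ x ∈ (C' : Set X)
  · -- (c) two members through `x`
    obtain ⟨C₁, hC₁, h10, hxC₁⟩ := h1
    obtain ⟨f, g, hfg, hf, hg⟩ := hc C₀ hC₀ C₁ hC₁ (Ne.symm h10) x ⟨hxC₀, hxC₁⟩
    -- a member through `x` is `C₀` or `C₁`
    have honly : ∀ D : {D : X.IdealSheafData // D ∈ E ∧ x ∈ D.support},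
        D.1 = vanishingIdeal C₀ ∨ D.1 = vanishingIdeal C₁ := by
      intro D
      obtain ⟨C, hC, hCD, hxC⟩ := hthrough D
      rcases hn x C₀ hC₀ C₁ hC₁ C hC hxC₀ hxC₁ hxC with h | h | h
      · exact absurd h h10.symm
      · exact Or.inl (by rw [← hCD, h])
      · exact Or.inr (by rw [← hCD, h])
    have hne01 : vanishingIdeal C₀ ≠ vanishingIdeal C₁ := fun h => h10 (hinjV h).symm
    refine labels_of_isRsopPart E hfg
      (fun D => if D.1 = vanishingIdeal C₀ then (0 : Fin 2) else 1) (fun D₁ D₂ h => ?_) (fun D => ?_)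
    · -- injective
      apply Subtype.ext
      by_cases h₁ : D₁.1 = vanishingIdeal C₀ <;> by_cases h₂ : D₂.1 = vanishingIdeal C₀
      · rw [h₁, h₂]
      · simp only [h₁, h₂, if_true, if_false] at h
        exact absurd h (by decide)
      · simp only [h₁, h₂, if_true, if_false] at h
        exact absurd h (by decide)
      · rw [(honly D₁).resolve_left h₁, (honly D₂).resolve_left h₂]
    · -- the germs
      by_cases h₁ : D.1 = vanishingIdeal C₀
      · simp only [h₁, if_true]
        rw [hf]
        rfl
      · simp only [h₁, if_false]
        rw [(honly D).resolve_left h₁, hg]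
        rfl
  · -- (b) exactly one member through `x`
    obtain ⟨f, hf, hfC⟩ := hb C₀ hC₀ x hxC₀
    have honly : ∀ D : {D : X.IdealSheafData // D ∈ E ∧ x ∈ D.support}, D.1 = vanishingIdeal C₀ := by
      intro D
      obtain ⟨C, hC, hCD, hxC⟩ := hthrough D
      by_cases hCC : C = C₀
      · rw [← hCD, hCC]
      · exact absurd ⟨C, hC, hCC, hxC⟩ h1
    refine labels_of_isRsopPart E hf (fun _ => (0 : Fin 1)) (fun D₁ D₂ _ => ?_) (fun D => ?_)
    · exact Subtype.ext ((honly D₁).trans (honly D₂).symm)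
    · rw [honly D, hfC]
      rfl

/-- **A configuration of regular, pairwise transversal curves with no triple point is a strict normal
crossings divisor** (Stacks Tag 0BIC, proof ¶2, last sentence, via Tag 0BIA): with hypotheses (o), (b),
(c), (n) of `hasSNC_of_curveConfiguration`, the union `⋃_{C ∈ 𝒞} C` is a strict normal crossings divisor
on `X`. [cite: StacksProject, Tag 0BIC (Lemma 54.15.6, proof ¶2)] [cite: StacksProject, Tag 0BIA (Lemma 41.21.2)] -/
theorem isStrictNormalCrossingsDivisor_biUnion_of_curveConfiguration
    (hreg : ∀ x : X, IsRegularLocalRing (X.presheaf.stalk x))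
    {𝒞 : Set (Closeds X)} (hfin : 𝒞.Finite)
    (hb : ∀ C ∈ 𝒞, ∀ p ∈ (C : Set X), ∃ f : X.presheaf.stalk p,
      IsRsopPart ![f] ∧ stalkIdeal (vanishingIdeal C) p = Ideal.span {f})
    (hc : ∀ C ∈ 𝒞, ∀ C' ∈ 𝒞, C ≠ C' → ∀ p ∈ (C : Set X) ∩ (C' : Set X),
      ∃ f g : X.presheaf.stalk p, IsRsopPart ![f, g] ∧
        stalkIdeal (vanishingIdeal C) p = Ideal.span {f} ∧ stalkIdeal (vanishingIdeal C') p = Ideal.span {g})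
    (hn : ∀ p : X, ∀ C₁ ∈ 𝒞, ∀ C₂ ∈ 𝒞, ∀ C₃ ∈ 𝒞, p ∈ (C₁ : Set X) → p ∈ (C₂ : Set X) → p ∈ (C₃ : Set X) →
      C₁ = C₂ ∨ C₁ = C₃ ∨ C₂ = C₃) :
    IsStrictNormalCrossingsDivisor X (⋃ C ∈ 𝒞, (C : Set X)) := by
  classical
  have h := (hasSNC_of_curveConfiguration hreg hfin hb hc hn).isStrictNormalCrossingsDivisor_biUnion_support
  have hU : (⋃ D ∈ (hfin.toFinset.toList).map (fun C => vanishingIdeal C), (D.support : Set X)) =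
      ⋃ C ∈ 𝒞, (C : Set X) := by
    ext y
    simp only [Set.mem_iUnion, List.mem_map, Finset.mem_toList, Set.Finite.mem_toFinset, exists_prop]
    constructor
    · rintro ⟨D, ⟨C, hC, rfl⟩, hy⟩
      exact ⟨C, hC, by rwa [coe_support_vanishingIdeal] at hy⟩
    · rintro ⟨C, hC, hy⟩
      exact ⟨vanishingIdeal C, ⟨C, hC, rfl⟩, by rwa [coe_support_vanishingIdeal]⟩
  rwa [hU] at h

end Literature.AlgebraicGeometry.Resolution

end
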